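import Summits.QuantumFields.BalabanUV.T4Continuum.Support.NE3EnergyShapes
import Summits.QuantumFields.BalabanUV.T4Continuum.Support.NE3HessForm
import HarnessLib

/-!
# T⁴ programme, node NE3 — the η-WEIGHTED energy currency for the local half: `energyNormW`, the re-typed root T-E_w
# (`NE3EnergyRateW`), the two repair leaves (ML_w) and (RES♯) as hypothesis SHAPES, and the bookkeeping between the currencies

NE3 prover lineage P1, gen 19 (cell `pub-balaban`, unit `b2b-balaban-t4-ne3-p1`, row NE3 OWNER).  CONTEXT: located error
G-ne3p1-g19-1 (HOME/GAPS.md; kernel no-go `NE3TangentNoGo.no_uniform_tangent_coercivity`): the energy-convexity road to P2's root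
`NE3EnergyShapes.NE3EnergyRate` (T-E, unit-scale energy norm `energyNorm = √(curlSq + dirSq)`) has no surviving derivation — its
tangent-coercivity leaf is false k-uniformly in the unit-scale norm, and in the consistent η-weighted currency the residual leaf as
proved gives no rate.  The repair census' surviving variant (R3) lives in Bałaban's own (physical, η-weighted) currency.  THIS FILE
TYPES that currency and the variant's root and leaves — as SHAPES (`def … : Prop` with parameters, asserted for nothing except the
flat datum) — so that successor seats have tree names to discharge or refute:

* `energyNormW L k W Z F := √(curlSq W Z F + ((L^k)⁻¹)²·dirSq Z F)` — the level-`k` η-weighted energy norm (`η = L^{−k}`: the bond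
  term carries `η²`, exactly B9 (3.46)'s `(L^jη)²` bookkeeping); `energyNormW ≤ energyNorm` (`L ≥ 1`);
* **T-E_w** `NE3EnergyRateW 𝒞 L N b g C dom` — VERBATIM `NE3EnergyRate` with `energyNorm` replaced by `energyNormW L k`;
  `NE3EnergyRate → NE3EnergyRateW` (the re-typed root is WEAKER: every derivation of T-E is one of T-E_w; the converse is the content
  of the located error);
* **(ML_w)** `WeightedTangentCoercive L k W T c F` — `∀ Y ∈ T, c·energyNormW L k W Y F² ≤ hess W Y Y (F ×ˢ univ)`: weighted
  tangent coercivity (B9 Thm 3.3 ∕ B6 (2.153) TYPE in their own η-units; flat core = lattice Weitzenböck + block-Poincaré on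
  ker d(avgIter k), NOT in the tree);
* **(RES♯)** `CurlPairedResidual L k W T r F` — `∀ Y ∈ T, |dAction W Y (F ×ˢ univ)| ≤ r·energyNormW L k W Y F`: the dual residual
  of the competitor in the weighted DUAL norm (the flux-gradient term must pair with `√curlSq`, cf. the abelian corner cancellation
  `B7Prop1Explicit.corner_cancellation`: `d(QA) = Q′(dA)`); with `r = C·residualScale` this is what the convexity lemma
  `NE3EnergyPath.energyResponse_of_pathData` consumes in the weighted currency;
* non-vacuity on the flat datum (`ne3EnergyRateW_flat`), and the flat instances of the two shapes with the zero direction space.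

HONEST FRAMING.  SHAPES and bookkeeping only: NOTHING here is proved about Bałaban's minimisers; (ML_w), (RES♯), T-E_w are
HYPOTHESIS∕TARGET shapes of OUR repaired frame, none printed as such (context: [Balaban1985PropagatorsII] Thm 3.3 (3.46) p.397,
[Balaban1984PropagatorsII] (2.153) p.249 — η-weighted statements); NE3 NOT proved; spine 0∕9; finite T⁴ rung (B)+1 — NOT infinite
volume, NOT mass gap, NOT Clay.  PLACEMENT: `Summits/QuantumFields/BalabanUV/`.
-/

set_option autoImplicit false

open scoped BigOperators Matrix Matrix.Norms.L2Operator
open Finset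

namespace Summit.QuantumFields.BalabanUV.T4Continuum.NE3EnergyWeightedShapes

open Literature.MathematicalPhysics.QuantumFieldTheory.Balaban1983to89
open B7Prop1Explicit B7Prop2Explicit
open T4AveragingDeficitWall hiding Site Plane Plaq Bond
open T4AveragingDeficitWallBoundary (IsPeriodicCfg periodBox)
open AveragingDeficitPeriodicCounting (IsPeriodicDir)
open MinimalActionSandwich (IsMinimiser)
open MinimalActionRate (Regular)
open MinimalActionWitness (flatCfg flatClass)
open NE3EnergyShapes (energyNorm energyNorm_nonneg residualScale residualScale_nonneg IsUnitarySite IsPeriodicSite NE3EnergyRate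
  gaugeAct_one rescale_bavg_flatCfg energyNorm_zero)

noncomputable section

variable {d : ℕ} {n : Type*} [Fintype n] [DecidableEq n]

/-! ## §1 The η-weighted energy norm of level `k` -/

/-- **THE η-WEIGHTED ENERGY NORM OF LEVEL `k`** of a direction `Z` at the background `W` over the site set `F`:
`√(Σ‖(d_W Z)(p)‖² + (L^k)⁻²·Σ‖Z(b)‖²)` — the curl at unit weight, the bond term at weight `η² = L^{−2k}` (B9 (3.46)'s
`(L^jη)²`, read on run A's unit lattice of level `k`). [folklore] -/
def energyNormW (L k : ℕ) (W : Site d → Fin d → (Matrix n n ℂ)ˣ) (Z : Site d → Fin d → Matrix n n ℂ)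
    (F : Finset (Site d)) : ℝ :=
  Real.sqrt (curlSq W Z F + (((L : ℝ) ^ k)⁻¹) ^ 2 * dirSq Z F)

/-- The weighted energy norm is non-negative. [folklore] -/
theorem energyNormW_nonneg (L k : ℕ) (W : Site d → Fin d → (Matrix n n ℂ)ˣ) (Z : Site d → Fin d → Matrix n n ℂ)
    (F : Finset (Site d)) : 0 ≤ energyNormW L k W Z F := Real.sqrt_nonneg _

/-- The weighted energy norm of the zero direction vanishes. [folklore] -/
theorem energyNormW_zero (L k : ℕ) (W : Site d → Fin d → (Matrix n n ℂ)ˣ) (F : Finset (Site d)) :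
    energyNormW L k W (fun _ _ => 0) F = 0 := by
  unfold energyNormW curlSq dirSq
  simp

/-- **THE WEIGHTED NORM IS DOMINATED BY THE UNIT-SCALE NORM** (`L ≥ 1`): `energyNormW L k W Z F ≤ energyNorm W Z F`. [folklore] -/
theorem energyNormW_le_energyNorm {L : ℕ} (hL : 1 ≤ L) (k : ℕ) (W : Site d → Fin d → (Matrix n n ℂ)ˣ)
    (Z : Site d → Fin d → Matrix n n ℂ) (F : Finset (Site d)) : energyNormW L k W Z F ≤ energyNorm W Z F := by
  unfold energyNormW NE3EnergyShapes.energyNorm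
  refine Real.sqrt_le_sqrt ?_
  have hD : 0 ≤ dirSq Z F := by unfold dirSq; positivity
  have hL1 : (1 : ℝ) ≤ (L : ℝ) ^ k := one_le_pow₀ (by exact_mod_cast hL)
  have hw : (((L : ℝ) ^ k)⁻¹) ^ 2 ≤ 1 := by
    have h1 : ((L : ℝ) ^ k)⁻¹ ≤ 1 := inv_le_one_of_one_le₀ hL1
    have h0 : 0 ≤ ((L : ℝ) ^ k)⁻¹ := by positivity
    nlinarith
  nlinarith

/-- … and dominates the curl alone: `√(curlSq W Z F) ≤ energyNormW L k W Z F`. [folklore] -/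
theorem sqrt_curlSq_le_energyNormW (L k : ℕ) (W : Site d → Fin d → (Matrix n n ℂ)ˣ) (Z : Site d → Fin d → Matrix n n ℂ)
    (F : Finset (Site d)) : Real.sqrt (curlSq W Z F) ≤ energyNormW L k W Z F := by
  unfold energyNormW
  refine Real.sqrt_le_sqrt ?_
  have hD : 0 ≤ dirSq Z F := by unfold dirSq; positivity
  nlinarith [sq_nonneg (((L : ℝ) ^ k)⁻¹)]

/-- … and `L^{−k}` times the bond norm: `(L^k)⁻¹·√(dirSq Z F) ≤ energyNormW L k W Z F` (`L ≥ 1`). [folklore] -/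
theorem weighted_sqrt_dirSq_le_energyNormW {L : ℕ} (hL : 1 ≤ L) (k : ℕ) (W : Site d → Fin d → (Matrix n n ℂ)ˣ)
    (Z : Site d → Fin d → Matrix n n ℂ) (F : Finset (Site d)) :
    ((L : ℝ) ^ k)⁻¹ * Real.sqrt (dirSq Z F) ≤ energyNormW L k W Z F := by
  unfold energyNormW
  have h0 : 0 ≤ ((L : ℝ) ^ k)⁻¹ := by
    have : (0 : ℝ) < (L : ℝ) ^ k := pow_pos (by exact_mod_cast (by omega : 0 < L)) k
    positivity
  have hC : 0 ≤ curlSq W Z F := by unfold curlSq; positivity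
  calc ((L : ℝ) ^ k)⁻¹ * Real.sqrt (dirSq Z F) = Real.sqrt ((((L : ℝ) ^ k)⁻¹) ^ 2 * dirSq Z F) := by
        rw [Real.sqrt_mul (sq_nonneg _), Real.sqrt_sq h0]
    _ ≤ Real.sqrt (curlSq W Z F + (((L : ℝ) ^ k)⁻¹) ^ 2 * dirSq Z F) := Real.sqrt_le_sqrt (by linarith)

/-! ## §2 The re-typed root T-E_w -/

variable (d) in
/-- **T-E_w — NE3 IN THE η-WEIGHTED ENERGY-DISTANCE READING** (a `Prop`; asserted for no class here except the flat one below):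
VERBATIM `NE3EnergyShapes.NE3EnergyRate` with the unit-scale `energyNorm` replaced by `energyNormW L k` of the run-A level `k`.
The surviving variant (R3) of the repair census G-ne3p1-g19-1 targets THIS shape. A hypothesis∕target SHAPE of ours. [folklore] -/
@[folklore]
def NE3EnergyRateW (𝒞 : ℕ → Set (Site d → Fin d → (Matrix n n ℂ)ˣ)) (L N : ℕ) (b g C : ℝ)
    (dom : Set (Site d → Fin d → (Matrix n n ℂ)ˣ)) : Prop :=
  ∀ k : ℕ, 1 ≤ k → ∀ V ∈ dom, ∀ UA UB : Site d → Fin d → (Matrix n n ℂ)ˣ,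
    IsMinimiser d 𝒞 L N k V UA → IsMinimiser d 𝒞 L N (k + 1) V UB → Regular d L N b g (k + 1) UB →
      ∃ (u : Site d → (Matrix n n ℂ)ˣ) (Z : Site d → Fin d → Matrix n n ℂ),
        IsUnitarySite u ∧ IsPeriodicSite u ((N * L ^ k : ℕ) : ℤ) ∧
        IsSkewDir Z ∧ IsPeriodicDir Z ((N * L ^ k : ℕ) : ℤ) ∧
        gaugeAct u UA = vary (rescale L (bavg L UB)) Z 1 ∧
        energyNormW L k (rescale L (bavg L UB)) Z (periodBox (N * L ^ k)) ≤ C * residualScale d L N b g k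

/-- **THE RE-TYPED ROOT IS WEAKER**: every instance of P2's T-E is an instance of T-E_w (`L ≥ 1`) — all kernel consumers that can
be re-derived from T-E_w inherit every future derivation of T-E, and the located error says the converse road is closed. [folklore] -/
theorem ne3EnergyRateW_of_ne3EnergyRate {𝒞 : ℕ → Set (Site d → Fin d → (Matrix n n ℂ)ˣ)} {L N : ℕ} (hL : 1 ≤ L)
    {b g C : ℝ} {dom : Set (Site d → Fin d → (Matrix n n ℂ)ˣ)} (h : NE3EnergyRate d 𝒞 L N b g C dom) :
    NE3EnergyRateW d 𝒞 L N b g C dom := by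
  intro k hk V hV UA UB hA hB hreg
  obtain ⟨u, Z, hu, huP, hZ, hZP, hrep, hE⟩ := h k hk V hV UA UB hA hB hreg
  exact ⟨u, Z, hu, huP, hZ, hZP, hrep, (energyNormW_le_energyNorm hL k _ Z _).trans hE⟩

/-- NON-VACUITY: in the flat class with the flat datum T-E_w holds for every `C ≥ 0` (both minimisers flat, `u = 1`, `Z = 0`).
[folklore] -/
theorem ne3EnergyRateW_flat [Nonempty n] (L N : ℕ) (b g : ℝ) {C : ℝ} (hC : 0 ≤ C) :
    NE3EnergyRateW d (flatClass (n := n)) L N b g C {flatCfg} := by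
  intro k _ V _ UA UB hA hB _
  have hUA : UA = flatCfg := by simpa [flatClass, MinimalActionSandwich.admissible] using hA.mem.1
  have hUB : UB = flatCfg := by simpa [flatClass, MinimalActionSandwich.admissible] using hB.mem.1
  refine ⟨fun _ => 1, fun (_ : Site d) (_ : Fin d) => (0 : Matrix n n ℂ), fun _ => (unitaryUnits _).one_mem,
    fun _ _ => rfl, fun _ _ => (skewAdjoint _).zero_mem, fun _ _ _ => rfl, ?_, ?_⟩
  · rw [hUA, hUB, rescale_bavg_flatCfg, gaugeAct_one, vary_zero_dir]
  · rw [energyNormW_zero]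
    exact mul_nonneg hC (residualScale_nonneg d L N b g k)

/-! ## §3 The two repair leaves as hypothesis SHAPES -/

/-- **(ML_w) WEIGHTED TANGENT COERCIVITY** at the background `W`, on the direction set `T`, constant `c`, over the site set `F`:
`∀ Y ∈ T, c·energyNormW L k W Y F² ≤ hess W Y Y (F ×ˢ univ)`.  B9 Thm 3.3 (3.46) ∕ B6 (2.153) TYPE in THEIR (η-weighted)
currency; its unit-scale analogue is refuted k-uniformly (`NE3TangentNoGo`).  A hypothesis SHAPE, asserted for nothing. [folklore] -/
@[folklore]
def WeightedTangentCoercive (L k : ℕ) (W : Site d → Fin d → (Matrix n n ℂ)ˣ)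
    (T : Set (Site d → Fin d → Matrix n n ℂ)) (c : ℝ) (F : Finset (Site d)) : Prop :=
  ∀ Y ∈ T, c * energyNormW L k W Y F ^ 2 ≤ NE3HessForm.hess W Y Y (F ×ˢ Finset.univ)

/-- **(RES♯) CURL-PAIRED DUAL RESIDUAL** of the background `W` on the direction set `T`, size `r`, over the site set `F`:
`∀ Y ∈ T, |dAction W Y (F ×ˢ univ)| ≤ r·energyNormW L k W Y F` — the first variation of the Wilson action at the competitor,
measured in the weighted DUAL norm (so the flux-gradient part must pair with `√curlSq`, the `a`- and `a²`-weighted parts may pair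
with `‖Y‖_ℓ²`).  Row NE3-R2's `dualResidual_avgIter` proves the ℓ²-paired (unit-dual) form only.  A hypothesis SHAPE. [folklore] -/
@[folklore]
def CurlPairedResidual (L k : ℕ) (W : Site d → Fin d → (Matrix n n ℂ)ˣ)
    (T : Set (Site d → Fin d → Matrix n n ℂ)) (r : ℝ) (F : Finset (Site d)) : Prop :=
  ∀ Y ∈ T, |NE3HessForm.dAction W Y (F ×ˢ Finset.univ)| ≤ r * energyNormW L k W Y F

/-- Non-vacuity of (ML_w): on the zero direction space every constant works. [folklore] -/
theorem weightedTangentCoercive_zero (L k : ℕ) (W : Site d → Fin d → (Matrix n n ℂ)ˣ) (c : ℝ) (F : Finset (Site d)) :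
    WeightedTangentCoercive L k W {fun _ _ => 0} c F := by
  intro Y hY
  rw [Set.mem_singleton_iff] at hY
  subst hY
  rw [energyNormW_zero]
  have : NE3HessForm.hess W (fun (_ : Site d) (_ : Fin d) => (0 : Matrix n n ℂ)) (fun _ _ => 0) (F ×ˢ Finset.univ) = 0 := by
    unfold NE3HessForm.hess NE3HessForm.hessPlaq NE3HessForm.hessPlaqAt NE3HessForm.dcurlAt
    simp [curlAt, Ad, UnitaryModel.nReTr]
  rw [this]; simp

/-- Non-vacuity of (RES♯): on the zero direction space every `r` works. [folklore] -/
theorem curlPairedResidual_zero (L k : ℕ) (W : Site d → Fin d → (Matrix n n ℂ)ˣ) (r : ℝ) (F : Finset (Site d)) :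
    CurlPairedResidual L k W {fun _ _ => 0} r F := by
  intro Y hY
  rw [Set.mem_singleton_iff] at hY
  subst hY
  rw [energyNormW_zero, mul_zero]
  have : NE3HessForm.dAction W (fun (_ : Site d) (_ : Fin d) => (0 : Matrix n n ℂ)) (F ×ˢ Finset.univ) = 0 := by
    unfold NE3HessForm.dAction
    simp [curl, curlAt, Ad, UnitaryModel.nReTr]
  rw [this, abs_zero]

end

end Summit.QuantumFields.BalabanUV.T4Continuum.NE3EnergyWeightedShapes
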